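import Literature.MathematicalPhysics.QuantumFieldTheory.Balaban1983to89.Beta.RemainderOriginTowerPlaquette
import Literature.MathematicalPhysics.QuantumFieldTheory.Balaban1983to89.Beta.RemainderTowerDisplayIrrel

/-!
# T. Bałaban, *The variational problem and background fields …*, Commun. Math. Phys. **102** (1985) 277–309 [Balaban1985Variational] (182) p. 307, (190)
# p. 308, (129) p. 297, with [Balaban1985BackgroundPropagators] (3.35)–(3.37) p. 396, Thm 3.3 (3.42) pp. 397–399, Thm 3.11 p. 416, (3.126) p. 420,
# (3.132)–(3.133) p. 422, (3.137) p. 423: **NODE D OF ROW (D4) AT THE ORIGIN ON PRINT's SMALL-FIELD CLASS — THE CONSUMER's FORM: «Y12a» §3 ∕ «Y12b» READ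
# AT ANY ADMISSIBLE REGULARITY DISPLAY, ONTO-THRESHOLD AND POSITIVITY WITNESS THE CONSUMER HOLDS** (the `∃ αU hα1 hαL hU1 hreg hpos` packaging replaced
# by `∀ αU hα1 hαL hU1 hreg hpos` through «Y12c» `Beta.RemainderTowerDisplayIrrel`)

CITATION HEADER (lean-in-tree rule 2026-08-18).  Sources and loci exactly as in «Y12a» `Beta.RemainderHasMajH1kTowerPlaquette` ∕ «Y12b»
`Beta.RemainderOriginTowerPlaquette` (this lineage, gen 112): [Balaban1985Variational] (B11 = [15]; held `paper:balaban1985-cmp102-variational-background`,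
journal page = PDF page + 276) (129) p. 297, (180) p. 306, (182) p. 307, (190) p. 308; [Balaban1985BackgroundPropagators] (B9 = [5];
`paper:balaban1985-cmp99-background-propagators`, journal page = PDF page + 388) (3.15)–(3.16) p. 393, (3.26) p. 395, (3.35)–(3.37) p. 396, Thm 3.1 (3.42)
p. 397, Thm 3.3 p. 399, Thm 3.11 p. 416, (3.126) p. 420, (3.132)–(3.133) p. 422, (3.137) p. 423; [Balaban1985Averaging] (B7 = [4]) Prop. 2 (52)–(54) p. 26,
(122) p. 36, (18) p. 21; [Balaban1984PropagatorsII] (B6) (2.51)–(2.52) p. 232, (2.54) p. 233, Lemma 2.1 (2.61) p. 234.  Nothing of print is asserted here.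

WHY THIS FILE (audit cell `pub-balaban`, BINDER row (D4), OWNER lineage `b2b-balaban-beta-an4`, gen 112; «Y12f»).  «Y12a» §3
`exists_hasMaj_H1k_tower_plaquette` and «Y12b» `exists_ineq190_origin_tower_plaquette` conclude `∃ αU hα1 hαL hU1 hreg hpos, … (H1k … αU … hαL hpos) …`
with a display and a witness DERIVED inside; a consumer who already holds a display `αU` (with `hα1`, `hαL`, `hU1`, `hreg`) and a positivity witness
`hpos` of `Δ_{a,k}(U)` — e.g. the NE9 cell's own — wants the statement AT ITS terms.  «Y12c» proves the operators `Q_k(U)`, `Δ_{a,k}(U)`, `G₁,k(U)`,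
`H₁,k(U)` do not depend on these data, so THIS FILE re-reads both theorems with the display ∕ threshold ∕ witness UNIVERSALLY quantified:
* **`exists_hasMaj_H1k_tower_plaquette_anyDisplay`** — [5] (3.133) first entry for `H₁,k(U)` on print's class, `∃ (α⋆, B, δ, A′, r₁)` first, for EVERY
  admissible `(αU, hα1, hαL, hU1, hreg, hpos)`: `HasMaj S^{coarse}_m S^{fine}_m (H1k … αU hα1 hU1 hreg … hαL hpos)ᵉ↾ℝ (…)`;
* **`exists_ineq190_origin_tower_plaquette_anyDisplay`** — THE END on print's class for EVERY admissible `(αU, …, hpos)`: «Y12b»'s conclusion with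
  `laplaceAk … αU …`, `QkW … αU …`, `H1k … αU … hαL hpos` the consumer's terms.
Mechanism: «Y12a»∕«Y12b» give `(αU′, …, hpos′)` and the statement at them; `rw [H1k_display_irrel, laplaceAk_display_irrel, QkW_display_irrel]`.

HONEST SCOPE.  [folklore] bookkeeping: one `obtain` + three `rw` per theorem («Y12c»'s display ∕ witness irrelevance); NO estimate of [5], [15] or [4]
is proved here; what stays displayed is exactly as in «Y12b» (print's three windows read GLOBALLY on the torus, the weights `ρ_w`, the Hilbert-structure
letters, `Δ⁽²⁾`'s (3.137) majorant — NODE-O-class identification NOT done —, the two smallnesses in `λ`).  Nothing identifies Bałaban's step-`k` objects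
(NODE O ∕ A FROZEN (0)).  Row (D4) class UNCHANGED (instance 0∕1; D4 DISCHARGE NO DATE); NOT B12 Thm 2, NOT BetaPertH, NOT continuum, NOT Clay.  HONEST
DEPENDENCY (cell line): continuum YM on T⁴ ⇐ BetaPertH ∧ nine spine estimates (0/9 proved); BetaPertH ⇐ (D1) ∧ (D4) ∧ CAP+tail; G-an2-4 gates asym, D1 and
NE2/3/4.  NEW file; nothing modified; 0 `def`; standard axioms; no `sorry`; `maxHeartbeats` ×2 per theorem (the sixty-binder statements, as «Y5b»∕«Y7»∕«Y10»).
Net new unproved facts: 0.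
-/

noncomputable section

open scoped BigOperators InnerProductSpace ComplexConjugate

namespace Literature.MathematicalPhysics.QuantumFieldTheory.Balaban1983to89.Beta.RemainderOriginTowerPlaquetteAnyDisplay

open B11SectG B11SupSize190
open B4Sect5Torus (TSite tdist tdist_nonneg)
open B4Sect5Proof (latticeConst)
open B5TorusCover (UT)
open B9Thm34Ext (toB6)
open B9Thm37GlueTorus (torusGeom tdist1)
open B9SectCLatticeCarrier (Bond bpos unshift)
open B9Eq311L2Pairing (WL2)
open B9Eq319QprimeTorus (blockCoord)
open B9Eq315QTower (towerP UlevOf)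
open B9Eq315QTorus (perCfg perCfg_apply cornerSite)
open B9Eq316TowerFlatIsOneStep (siteCast towerP_eq_fineP_pow)
open B7Prop1Explicit (U1 Wcx boxVec)
open B7Prop2Explicit (pdev AvgClosed C0 c2' C0_pos c2'_pos unitaryUnits avgClosed_unitaryUnits unitaryUnits_le_U1)
open B7Eq43AveragedSmallnessLevelFree (UlevOf_mem pdev_perCfg_le_of_plaq exists_profile_of_windows_eta)
open B11Eq44COperatorTower (αT αT_le ulev_mem_U1_of_pdev ulev_reg_of_pdev)
open B9Eq315QTowerRegularityDisplay (profile_le_αT)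
open B9Eq315QTowerRegularityProfile (ulev_reg_geometric)
open B9Eq310DeltaPrime (plaqHolU)
open B9Eq310HessianOperator (adTransportW)
open B9Eq310HessianHermitian (adTransportW_adjoint)
open B11Eq103H1Complex (SiteL2K BondL2K KinvLatticeK covDerivL2K)
open B9Eq326OperatorTower (laplaceAk QkW G1k H1k)
open B9Eq324DeltaPrimeATower (laplacePrimeAk)
open B9Eq342GreenPrimeSupBound (norm_adTransportW_eq)
open B9Eq326OperatorTowerRealityUnitary (star_val_eq_inv_of_mem_unitaryUnits forall_star_eq_inv_of_mem)
open B9Thm311LaplaceAkPositiveDiagonal (exists_laplaceAk_pos_diagonal_closed)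
open B9Thm311SitePrimeFormCoerciveTowerCanonical (exists_strong_site_coercive_tower_diagonal)
open Beta.RemainderHasMajH1kTowerPlaquette (exists_hasMaj_H1k_tower_plaquette)
open Beta.RemainderOriginTowerPlaquette (exists_ineq190_origin_tower_plaquette)
open Beta.RemainderTowerDisplayIrrel (QkW_display_irrel laplaceAk_display_irrel H1k_display_irrel)

/-! ## The value line at ANY display ∕ witness -/

section Tower

variable {d : ℕ} (hd : 1 ≤ d) (L : ℕ) [NeZero L] (hL : 1 ≤ L) (hL3 : 3 ≤ L)
  {𝔸 : Type*} [CStarAlgebra 𝔸] [Nontrivial 𝔸]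
  {W : Type} [NormedAddCommGroup W] [InnerProductSpace ℂ W] [FiniteDimensional ℂ W] (φ : W ≃ₗ[ℂ] 𝔸)
  {Mφ Mφ' : ℝ} (hMφ : 0 ≤ Mφ) (hMφ' : 0 ≤ Mφ') (hφ : ∀ w, ‖φ w‖ ≤ Mφ * ‖w‖) (hφ' : ∀ X, ‖φ.symm X‖ ≤ Mφ' * ‖X‖)
  {a : ℝ} (ha : 0 < a) {a' : ℝ} (ha' : 0 < a')
  (τ : 𝔸 →ₗ[ℂ] ℂ) {Cτ : ℝ} (hτ : ∀ X, ‖τ X‖ ≤ Cτ * ‖X‖) (hCτ : 0 ≤ Cτ) {Mτ : ℝ} (hτm : ∀ X Y : 𝔸, ‖τ (X * Y)‖ ≤ Mτ * ‖X‖ * ‖Y‖) (hMτ : 0 ≤ Mτ)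
  {ρw : ℝ} (hρw : 0 ≤ ρw)
  (hτ₁ : ∀ X : 𝔸, τ (star X) = conj (τ X)) (hτ₂ : ∀ X Y : 𝔸, τ (X * Y) = τ (Y * X)) (hφτ : ∀ X Y : 𝔸, ⟪φ.symm X, φ.symm Y⟫_ℂ = τ (star X * Y))
  (AQ : ℝ) (hAQ16 : 16 * ((d : ℝ) + 1) * ((d : ℝ) + 4) * c2' d L ≤ AQ)

set_option maxHeartbeats 400000 in
include hd hL hL3 hMφ hMφ' hφ hφ' ha ha' hτ hCτ hτm hMτ hρw hτ₁ hτ₂ hφτ hAQ16 in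
/-- **[5] (3.133), FIRST ENTRY, FOR `H₁,k(U)` ON PRINT's CLASS — AT ANY ADMISSIBLE DISPLAY ∕ WITNESS** («Y12a» `exists_hasMaj_H1k_tower_plaquette` read through
«Y12c» `H1k_display_irrel`): `∃ (α⋆, B, δ, A′, r₁)` first; then for every height on the diagonal, weights, period, `unitaryUnits`-valued `U` in the three-window
class with `0 ≤ α ≤ α⋆`, for EVERY regularity display `αU` with `hα1`, onto-threshold `hαL`, `hU1`, `hreg` and EVERY positivity witness `hpos` of `Δ_{a,k}(U)`
the consumer holds, every geometry and rates: `HasMaj S^{coarse}_m S^{fine}_m (H₁,k(U)ᵉ↾ℝ) (B·(M†eK_d(1))·e^{δ}·A′·c₀(1,σ)^d·e^{−ρ·d})` with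
`H₁,k(U) = B9Eq326OperatorTower.H1k … αU hα1 hU1 hreg … hαL hpos` — THE CONSUMER's TERM.  (Admissible displays EXIST on the class: «Y12a» `letters_of_windows`;
witnesses EXIST: `B9Thm311LaplaceAkPositiveDiagonal`.) [cite: Balaban1985BackgroundPropagators, (3.126) p.420, (3.132)–(3.133) p.422, Thm 3.3 (3.42) p.397+p.399,
Thm 3.11 p.416, (3.35)–(3.37) p.396, (3.15) p.393] [cite: Balaban1985Variational, (129) p.297, (190) p.308] [cite: Balaban1985Averaging, Prop. 2 (52)–(54) p.26, (122) p.36]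
[cite: Balaban1984PropagatorsII, (2.51)–(2.52) p.232, (2.54) p.233, Lemma 2.1 (2.61) p.234] -/
theorem exists_hasMaj_H1k_tower_plaquette_anyDisplay :
    ∃ αs B δ A' r₁ : ℝ, 0 < αs ∧ 0 ≤ B ∧ 0 < δ ∧ 0 ≤ A' ∧ 0 < r₁ ∧
      ∀ (n : ℕ) (η : ℝ) (_hηL : η * (L : ℝ) ^ (n + 1) = 1) (c₀ c₁ : ℝ) [Fact (0 < c₀)] [Fact (0 < c₁)]
        (_hw : c₀ * ((L : ℝ) ^ (n + 1)) ^ d = c₁) (_hρ : |η| ^ d / c₀ ≤ ρw) (m : Fin d → ℕ) [∀ i, NeZero (m i)] (_hm : ∀ i, 1 ≤ m i)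
        (U : Bond d (towerP L m (n + 1)) → 𝔸ˣ) (_hUu : ∀ b, U b ∈ unitaryUnits 𝔸)
        (α : ℝ) (_hα : 0 ≤ α) (_hαle : α ≤ αs) (_hUη : ∀ b, ‖(U b : 𝔸) - 1‖ ≤ α * η)
        (_hpl : ∀ p : B9SectCLatticeCarrier.Plaq d (towerP L m (n + 1)), ‖(plaqHolU U p : 𝔸) - 1‖ ≤ α * η ^ 2)
        (_hUgrad : ∀ (x : TSite d (towerP L m (n + 1))) (μ : Fin d), ‖(U (x, μ) : 𝔸) - U (unshift μ x, μ)‖ ≤ α * η ^ 2)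
        -- the consumer's OWN regularity display, onto-threshold and positivity witness (ANY admissible ones):
        (αU : ℕ → ℝ) (hα1 : ∀ j, αU j ≤ 1 / 64) (hαL : ∀ j, 50 * (d + 1) * αU j * (L : ℝ) ^ d ≤ 1 / 2)
        (hU1 : ∀ (j : ℕ) (x : B7Prop1Explicit.Site d) (k : Fin d), perCfg (towerP L m (j + 1)) (UlevOf L m (n + 1) U j) x k ∈ U1 𝔸)
        (hreg : ∀ (j : ℕ) (y : TSite d (towerP L m j)) (k : Fin d) (ρ' : Fin d → Fin L),
          ‖((Wcx L (perCfg (towerP L m (j + 1)) (UlevOf L m (n + 1) U j)) (cornerSite L y) k (boxVec L ρ') : 𝔸ˣ) : 𝔸) - 1‖ ≤ αU j)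
        (hpos : ∀ x : BondL2K ℂ d (towerP L m (n + 1)) c₀ W, x ≠ 0 →
          0 < RCLike.re ⟪x, laplaceAk L m n φ η U hL αU hα1 hU1 hreg τ (c₀ := c₀) (c₁ := c₁) a x⟫_ℂ)
        (η₀ L₀ M₀ R : ℝ) (H : Prop)
        (ρ σ : ℝ) (_hσ : 0 < σ) (_hρ0 : 0 ≤ ρ) (_hρI : ρ ≤ r₁ / d) (_hρ₁ : ρ + σ ≤ δ / d),
        HasMaj
          (supSize (toB6 (torusGeom m η₀ L₀ M₀) R H)
            (fun y => Finset.univ.filter fun c : Bond d m => bpos c = UT.toSite m y)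
            (fun c => UT.ofSite m (bpos c)) : BlockNorm (toB6 (torusGeom m η₀ L₀ M₀) R H) (Bond d m → W))
          (supSize (toB6 (torusGeom m η₀ L₀ M₀) R H)
            (fun y => Finset.univ.filter fun b : Bond d (towerP L m (n + 1)) =>
              blockCoord (L ^ (n + 1)) m (siteCast (towerP_eq_fineP_pow L m (n + 1)) (bpos b)) = UT.toSite m y)
            (fun b => UT.ofSite m (blockCoord (L ^ (n + 1)) m (siteCast (towerP_eq_fineP_pow L m (n + 1)) (bpos b)))) :
              BlockNorm (toB6 (torusGeom m η₀ L₀ M₀) R H) (Bond d (towerP L m (n + 1)) → W))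
          (((WL2.linearEquiv ℂ ℂ (fun _ : Bond d (towerP L m (n + 1)) => c₀) :
                BondL2K ℂ d (towerP L m (n + 1)) c₀ W ≃ₗ[ℂ] (Bond d (towerP L m (n + 1)) → W)).toLinearMap ∘ₗ
              H1k L m n φ η U hL αU hα1 hU1 hreg τ (c₀ := c₀) (c₁ := c₁) hαL hpos ∘ₗ
              (WL2.linearEquiv ℂ ℂ (fun _ : Bond d m => c₁) : BondL2K ℂ d m c₁ W ≃ₗ[ℂ] (Bond d m → W)).symm.toLinearMap).restrictScalars ℝ)
          (fun y v => B * ((Mφ' * Real.exp (100 * d * (d + 1) * (L : ℝ) ^ d * AQ) * Mφ * ((2 * d : ℕ) : ℝ)) * Real.exp 1 *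
              latticeConst d 1) * Real.exp δ * A' * (B6.c0 1 σ ^ d) *
            Real.exp (-(ρ * (toB6 (torusGeom m η₀ L₀ M₀) R H).dist y v))) := by
  obtain ⟨αs, B, δ, A', r₁, hαs, hB, hδ, hA', hr₁, HY⟩ := exists_hasMaj_H1k_tower_plaquette hd L hL hL3 φ hMφ hMφ' hφ hφ' ha ha' τ hτ hCτ hτm hMτ hρw hτ₁ hτ₂ hφτ AQ hAQ16
  refine ⟨αs, B, δ, A', r₁, hαs, hB, hδ, hA', hr₁, ?_⟩
  intro n η hηL c₀ c₁ _ _ hw hρ m _ hm U hUu α hα hαle hUη hpl hUgrad αU hα1 hαL hU1 hreg hpos η₀ L₀ M₀ R H ρ σ hσ hρ0 hρI hρ₁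
  obtain ⟨αU', hα1', hαL', hU1', hreg', hpos', h⟩ := HY n η hηL c₀ c₁ hw hρ m hm U hUu α hα hαle hUη hpl hUgrad η₀ L₀ M₀ R H ρ σ hσ hρ0 hρI hρ₁
  rw [H1k_display_irrel L m n φ η U hL αU' αU hα1' hα1 hU1' hU1 hreg' hreg τ hαL' hαL hpos' hpos] at h
  exact h

set_option maxHeartbeats 400000 in
include hd hL hL3 hMφ hMφ' hφ hφ' ha ha' hτ hCτ hτm hMτ hρw hτ₁ hτ₂ hφτ hAQ16 in
/-- **NODE D OF ROW (D4) AT THE ORIGIN ON PRINT's CLASS — THE END AT ANY ADMISSIBLE DISPLAY ∕ WITNESS** («Y12b» `exists_ineq190_origin_tower_plaquette` read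
through «Y12c» `H1k_display_irrel` ∕ `laplaceAk_display_irrel` ∕ `QkW_display_irrel`): `∃ (α⋆, B, δ, A′, r₁)` first; under the `∀` the diagonal, weights, period,
a `unitaryUnits`-valued `U` in the three-window class (`α ≤ α⋆`), THE CONSUMER's display `(αU, hα1, hαL, hU1, hreg)` and witness `hpos`, geometry, rates,
`Δ⁽²⁾`'s displayed (3.137) majorant, the derived constants (`rfl`) and the two smallnesses in `λ`; CONCLUSION: `G′ = (Δ_{a,k}(U) − Δ⁽²⁾)⁻¹`, `(Q_kG′Q_k†)⁻¹`
CONSTRUCTED two-sided and `∀ δ′, δ′∕8 ≤ ρ → Ineq190 S^{coarse}_m S^{fine}_m (H₀ + G̃Δ⁽²⁾H₀) (A₀ + B_G̃θ_Dc) δ′`, with `Δ_{a,k}(U) = laplaceAk … αU …`,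
`Q_k = QkW … αU …`, `H₀ = (H1k … αU … hαL hpos)ᵉ↾ℝ` THE CONSUMER's TERMS ([15] (182): `(δ/δB)𝓗(0) = H₀ + G̃Δ⁽²⁾H₀`; (190) at the origin).
[cite: Balaban1985Variational, (182) p.307, (190) p.308, (129)–(131) pp.297–298, (180) p.306] [cite: Balaban1985BackgroundPropagators, Thm 3.1 (3.42) p.397, Thm 3.3 p.399,
Thm 3.11 p.416, (3.35)–(3.37) p.396, (3.15) p.393, (3.26) p.395, (3.126) p.420, (3.132)–(3.133) p.422, (3.137)–(3.138) p.423] [cite: Balaban1985Averaging, Prop. 2 (52)–(54) p.26, (122) p.36]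
[cite: Balaban1984PropagatorsII, (2.51)–(2.52) p.232, (2.54) p.233, Lemma 2.1 (2.61) p.234] -/
theorem exists_ineq190_origin_tower_plaquette_anyDisplay :
    ∃ αs B δ A' r₁ : ℝ, 0 < αs ∧ 0 ≤ B ∧ 0 < δ ∧ 0 ≤ A' ∧ 0 < r₁ ∧
      ∀ (n : ℕ) (η : ℝ) (_hηL : η * (L : ℝ) ^ (n + 1) = 1) (c₀ c₁ : ℝ) [Fact (0 < c₀)] [Fact (0 < c₁)]
        (_hw : c₀ * ((L : ℝ) ^ (n + 1)) ^ d = c₁) (_hρ : |η| ^ d / c₀ ≤ ρw) (m : Fin d → ℕ) [∀ i, NeZero (m i)] (_hm : ∀ i, 1 ≤ m i)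
        (U : Bond d (towerP L m (n + 1)) → 𝔸ˣ) (_hUu : ∀ b, U b ∈ unitaryUnits 𝔸)
        (α : ℝ) (_hα : 0 ≤ α) (_hαle : α ≤ αs) (_hUη : ∀ b, ‖(U b : 𝔸) - 1‖ ≤ α * η)
        (_hpl : ∀ p : B9SectCLatticeCarrier.Plaq d (towerP L m (n + 1)), ‖(plaqHolU U p : 𝔸) - 1‖ ≤ α * η ^ 2)
        (_hUgrad : ∀ (x : TSite d (towerP L m (n + 1))) (μ : Fin d), ‖(U (x, μ) : 𝔸) - U (unshift μ x, μ)‖ ≤ α * η ^ 2)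
        -- the consumer's OWN regularity display, onto-threshold and positivity witness (ANY admissible ones):
        (αU : ℕ → ℝ) (hα1 : ∀ j, αU j ≤ 1 / 64) (hαL : ∀ j, 50 * (d + 1) * αU j * (L : ℝ) ^ d ≤ 1 / 2)
        (hU1 : ∀ (j : ℕ) (x : B7Prop1Explicit.Site d) (k : Fin d), perCfg (towerP L m (j + 1)) (UlevOf L m (n + 1) U j) x k ∈ U1 𝔸)
        (hreg : ∀ (j : ℕ) (y : TSite d (towerP L m j)) (k : Fin d) (ρ' : Fin d → Fin L),
          ‖((Wcx L (perCfg (towerP L m (j + 1)) (UlevOf L m (n + 1) U j)) (cornerSite L y) k (boxVec L ρ') : 𝔸ˣ) : 𝔸) - 1‖ ≤ αU j)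
        (hpos : ∀ x : BondL2K ℂ d (towerP L m (n + 1)) c₀ W, x ≠ 0 →
          0 < RCLike.re ⟪x, laplaceAk L m n φ η U hL αU hα1 hU1 hreg τ (c₀ := c₀) (c₁ := c₁) a x⟫_ℂ)
        (η₀ L₀ M₀ R : ℝ) (H : Prop)
        -- the rates and the (free) row-sum constant
        (ρ σ c : ℝ) (_hσ : 0 < σ) (_hρ0 : 0 ≤ ρ) (_hρ₁ : ρ + 5 * σ ≤ δ / d) (_hρI : ρ + 5 * σ ≤ r₁ / d) (_hc_def : c = B6.c0 1 σ ^ d)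
    -- `Δ⁽²⁾` DISPLAYED: a local operator on the fine carrier ((3.137): range `r_D`, row and column sums `≤ λ`)
    (D2 : BondL2K ℂ d (towerP L m (n + 1)) c₀ W →ₗ[ℂ] BondL2K ℂ d (towerP L m (n + 1)) c₀ W)
    {KD : UT m → UT m → ℝ} {lam rD : ℝ} (hlam : 0 ≤ lam) (hKD : ∀ y v, 0 ≤ KD y v)
    (hDloc : ∀ y v, KD y v ≠ 0 → (toB6 (torusGeom m η₀ L₀ M₀) R H).dist y v ≤ rD)
    (hDrow : ∀ y, ∑ v : UT m, KD y v ≤ lam) (hDcol : ∀ v, ∑ y : UT m, KD y v ≤ lam)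
    (hD2 : HasMaj
      (supSize (toB6 (torusGeom m η₀ L₀ M₀) R H)
        (fun y => Finset.univ.filter fun b : Bond d (towerP L m (n + 1)) =>
          blockCoord (L ^ (n + 1)) m (siteCast (towerP_eq_fineP_pow L m (n + 1)) (bpos b)) = UT.toSite m y)
        (fun b => UT.ofSite m (blockCoord (L ^ (n + 1)) m (siteCast (towerP_eq_fineP_pow L m (n + 1)) (bpos b)))) :
          BlockNorm (toB6 (torusGeom m η₀ L₀ M₀) R H) (Bond d (towerP L m (n + 1)) → W))
      (supSize (toB6 (torusGeom m η₀ L₀ M₀) R H)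
        (fun y => Finset.univ.filter fun b : Bond d (towerP L m (n + 1)) =>
          blockCoord (L ^ (n + 1)) m (siteCast (towerP_eq_fineP_pow L m (n + 1)) (bpos b)) = UT.toSite m y)
        (fun b => UT.ofSite m (blockCoord (L ^ (n + 1)) m (siteCast (towerP_eq_fineP_pow L m (n + 1)) (bpos b)))))
      (((WL2.linearEquiv ℂ ℂ (fun _ : Bond d (towerP L m (n + 1)) => c₀) :
            BondL2K ℂ d (towerP L m (n + 1)) c₀ W ≃ₗ[ℂ] (Bond d (towerP L m (n + 1)) → W)).toLinearMap ∘ₗ D2 ∘ₗ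
          (WL2.linearEquiv ℂ ℂ (fun _ : Bond d (towerP L m (n + 1)) => c₀) :
            BondL2K ℂ d (towerP L m (n + 1)) c₀ W ≃ₗ[ℂ] (Bond d (towerP L m (n + 1)) → W)).symm.toLinearMap).restrictScalars ℝ)
      KD)
    -- the derived constants, bound to their closed forms (instantiate with `rfl`), and the TWO smallnesses in `λ`
    {q BG' θP qI BI' A₀ θD BGt : ℝ}
    (hq_def : q = B * lam * Real.exp (δ / d * rD) * c) (hq : q < 1) (hBG' : BG' = B * (1 - q)⁻¹)
    (hθP : θP = B * lam * Real.exp (δ / d * rD) * BG' * c *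
      ((Mφ' * Real.exp (100 * d * (d + 1) * (L : ℝ) ^ d * AQ) * Mφ * ((2 * d : ℕ) : ℝ)) * Real.exp 1 * latticeConst d 1) *
      Real.exp ((ρ + 4 * σ) * d) * ((Mφ' * Mφ * Real.exp (50 * (d + 1) * AQ)) * Real.exp 1 * latticeConst d 1) *
      Real.exp ((ρ + 4 * σ) * d))
    (hqI : qI = A' * θP * c * c) (hqI1 : qI < 1) (hBI' : BI' = A' * (1 - qI)⁻¹)
    (hA₀ : A₀ = B * ((Mφ' * Real.exp (100 * d * (d + 1) * (L : ℝ) ^ d * AQ) * Mφ * ((2 * d : ℕ) : ℝ)) * Real.exp 1 *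
      latticeConst d 1) * Real.exp δ * A' * c)
    (hθD : θD = A₀ * lam * Real.exp (ρ * rD))
    (hBGt : BGt = BG' + ((Mφ' * Mφ * Real.exp (50 * (d + 1) * AQ)) * Real.exp 1 * latticeConst d 1) *
      ((Mφ' * Real.exp (100 * d * (d + 1) * (L : ℝ) ^ d * AQ) * Mφ * ((2 * d : ℕ) : ℝ)) * Real.exp 1 * latticeConst d 1) *
      BI' * BG' * BG' * Real.exp ((ρ + 2 * σ) * d) * Real.exp ((ρ + 2 * σ) * d) * c * c),
    ∃ (G' : (Bond d (towerP L m (n + 1)) → W) →L[ℂ] (Bond d (towerP L m (n + 1)) → W))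
      (Inv' : (Bond d m → W) →L[ℂ] (Bond d m → W)),
      -- `G′ = (Δ_{a,k}(U) − Δ⁽²⁾)⁻¹`, two-sided
      G' * (LinearMap.toContinuousLinearMap
          ((WL2.linearEquiv ℂ ℂ (fun _ : Bond d (towerP L m (n + 1)) => c₀) :
              BondL2K ℂ d (towerP L m (n + 1)) c₀ W ≃ₗ[ℂ] (Bond d (towerP L m (n + 1)) → W)).toLinearMap ∘ₗ
            laplaceAk L m n φ η U hL αU hα1 hU1 hreg τ (c₀ := c₀) (c₁ := c₁) a ∘ₗ
            (WL2.linearEquiv ℂ ℂ (fun _ : Bond d (towerP L m (n + 1)) => c₀) :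
              BondL2K ℂ d (towerP L m (n + 1)) c₀ W ≃ₗ[ℂ] (Bond d (towerP L m (n + 1)) → W)).symm.toLinearMap) -
        LinearMap.toContinuousLinearMap
          ((WL2.linearEquiv ℂ ℂ (fun _ : Bond d (towerP L m (n + 1)) => c₀) :
              BondL2K ℂ d (towerP L m (n + 1)) c₀ W ≃ₗ[ℂ] (Bond d (towerP L m (n + 1)) → W)).toLinearMap ∘ₗ D2 ∘ₗ
            (WL2.linearEquiv ℂ ℂ (fun _ : Bond d (towerP L m (n + 1)) => c₀) :
              BondL2K ℂ d (towerP L m (n + 1)) c₀ W ≃ₗ[ℂ] (Bond d (towerP L m (n + 1)) → W)).symm.toLinearMap)) = 1 ∧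
      (LinearMap.toContinuousLinearMap
          ((WL2.linearEquiv ℂ ℂ (fun _ : Bond d (towerP L m (n + 1)) => c₀) :
              BondL2K ℂ d (towerP L m (n + 1)) c₀ W ≃ₗ[ℂ] (Bond d (towerP L m (n + 1)) → W)).toLinearMap ∘ₗ
            laplaceAk L m n φ η U hL αU hα1 hU1 hreg τ (c₀ := c₀) (c₁ := c₁) a ∘ₗ
            (WL2.linearEquiv ℂ ℂ (fun _ : Bond d (towerP L m (n + 1)) => c₀) :
              BondL2K ℂ d (towerP L m (n + 1)) c₀ W ≃ₗ[ℂ] (Bond d (towerP L m (n + 1)) → W)).symm.toLinearMap) -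
        LinearMap.toContinuousLinearMap
          ((WL2.linearEquiv ℂ ℂ (fun _ : Bond d (towerP L m (n + 1)) => c₀) :
              BondL2K ℂ d (towerP L m (n + 1)) c₀ W ≃ₗ[ℂ] (Bond d (towerP L m (n + 1)) → W)).toLinearMap ∘ₗ D2 ∘ₗ
            (WL2.linearEquiv ℂ ℂ (fun _ : Bond d (towerP L m (n + 1)) => c₀) :
              BondL2K ℂ d (towerP L m (n + 1)) c₀ W ≃ₗ[ℂ] (Bond d (towerP L m (n + 1)) → W)).symm.toLinearMap)) * G' = 1 ∧
      -- `Inv′ = (Q_kG′Q_k†)⁻¹`, two-sided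
      Inv' * ((LinearMap.toContinuousLinearMap
          ((WL2.linearEquiv ℂ ℂ (fun _ : Bond d m => c₁) : BondL2K ℂ d m c₁ W ≃ₗ[ℂ] (Bond d m → W)).toLinearMap ∘ₗ
            QkW L m n φ U hL αU hα1 hU1 hreg (c₀ := c₀) (c₁ := c₁) ∘ₗ
            (WL2.linearEquiv ℂ ℂ (fun _ : Bond d (towerP L m (n + 1)) => c₀) :
              BondL2K ℂ d (towerP L m (n + 1)) c₀ W ≃ₗ[ℂ] (Bond d (towerP L m (n + 1)) → W)).symm.toLinearMap)).comp
        (G'.comp (LinearMap.toContinuousLinearMap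
          ((WL2.linearEquiv ℂ ℂ (fun _ : Bond d (towerP L m (n + 1)) => c₀) :
              BondL2K ℂ d (towerP L m (n + 1)) c₀ W ≃ₗ[ℂ] (Bond d (towerP L m (n + 1)) → W)).toLinearMap ∘ₗ
            LinearMap.adjoint (QkW L m n φ U hL αU hα1 hU1 hreg (c₀ := c₀) (c₁ := c₁)) ∘ₗ
            (WL2.linearEquiv ℂ ℂ (fun _ : Bond d m => c₁) : BondL2K ℂ d m c₁ W ≃ₗ[ℂ] (Bond d m → W)).symm.toLinearMap)))) = 1 ∧
      ((LinearMap.toContinuousLinearMap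
          ((WL2.linearEquiv ℂ ℂ (fun _ : Bond d m => c₁) : BondL2K ℂ d m c₁ W ≃ₗ[ℂ] (Bond d m → W)).toLinearMap ∘ₗ
            QkW L m n φ U hL αU hα1 hU1 hreg (c₀ := c₀) (c₁ := c₁) ∘ₗ
            (WL2.linearEquiv ℂ ℂ (fun _ : Bond d (towerP L m (n + 1)) => c₀) :
              BondL2K ℂ d (towerP L m (n + 1)) c₀ W ≃ₗ[ℂ] (Bond d (towerP L m (n + 1)) → W)).symm.toLinearMap)).comp
        (G'.comp (LinearMap.toContinuousLinearMap
          ((WL2.linearEquiv ℂ ℂ (fun _ : Bond d (towerP L m (n + 1)) => c₀) :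
              BondL2K ℂ d (towerP L m (n + 1)) c₀ W ≃ₗ[ℂ] (Bond d (towerP L m (n + 1)) → W)).toLinearMap ∘ₗ
            LinearMap.adjoint (QkW L m n φ U hL αU hα1 hU1 hreg (c₀ := c₀) (c₁ := c₁)) ∘ₗ
            (WL2.linearEquiv ℂ ℂ (fun _ : Bond d m => c₁) : BondL2K ℂ d m c₁ W ≃ₗ[ℂ] (Bond d m → W)).symm.toLinearMap)))) * Inv' = 1 ∧
      -- the (190) letter of `H₀ + G̃Δ⁽²⁾H₀`, `H₀ = H₁,k(U)` by name, `G̃ = G′ − G′Q_k†·Inv′·Q_kG′`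
      ∀ δ' : ℝ, δ' / 8 ≤ ρ →
        Ineq190
          (supSize (toB6 (torusGeom m η₀ L₀ M₀) R H)
            (fun y => Finset.univ.filter fun c : Bond d m => bpos c = UT.toSite m y)
            (fun c => UT.ofSite m (bpos c)) : BlockNorm (toB6 (torusGeom m η₀ L₀ M₀) R H) (Bond d m → W))
          (supSize (toB6 (torusGeom m η₀ L₀ M₀) R H)
            (fun y => Finset.univ.filter fun b : Bond d (towerP L m (n + 1)) =>
              blockCoord (L ^ (n + 1)) m (siteCast (towerP_eq_fineP_pow L m (n + 1)) (bpos b)) = UT.toSite m y)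
            (fun b => UT.ofSite m (blockCoord (L ^ (n + 1)) m (siteCast (towerP_eq_fineP_pow L m (n + 1)) (bpos b)))) :
              BlockNorm (toB6 (torusGeom m η₀ L₀ M₀) R H) (Bond d (towerP L m (n + 1)) → W))
          ((((WL2.linearEquiv ℂ ℂ (fun _ : Bond d (towerP L m (n + 1)) => c₀) :
                  BondL2K ℂ d (towerP L m (n + 1)) c₀ W ≃ₗ[ℂ] (Bond d (towerP L m (n + 1)) → W)).toLinearMap ∘ₗ
              H1k L m n φ η U hL αU hα1 hU1 hreg τ (c₀ := c₀) (c₁ := c₁) hαL hpos ∘ₗ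
              (WL2.linearEquiv ℂ ℂ (fun _ : Bond d m => c₁) : BondL2K ℂ d m c₁ W ≃ₗ[ℂ] (Bond d m → W)).symm.toLinearMap).restrictScalars ℝ) +
            ((G'.restrictScalars ℝ : (Bond d (towerP L m (n + 1)) → W) →ₗ[ℝ] (Bond d (towerP L m (n + 1)) → W)) -
              ((G'.restrictScalars ℝ : (Bond d (towerP L m (n + 1)) → W) →ₗ[ℝ] (Bond d (towerP L m (n + 1)) → W)) ∘ₗ
                (((WL2.linearEquiv ℂ ℂ (fun _ : Bond d (towerP L m (n + 1)) => c₀) :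
                      BondL2K ℂ d (towerP L m (n + 1)) c₀ W ≃ₗ[ℂ] (Bond d (towerP L m (n + 1)) → W)).toLinearMap ∘ₗ
                  LinearMap.adjoint (QkW L m n φ U hL αU hα1 hU1 hreg (c₀ := c₀) (c₁ := c₁)) ∘ₗ
                  (WL2.linearEquiv ℂ ℂ (fun _ : Bond d m => c₁) : BondL2K ℂ d m c₁ W ≃ₗ[ℂ] (Bond d m → W)).symm.toLinearMap).restrictScalars ℝ)) ∘ₗ
              (Inv'.restrictScalars ℝ : (Bond d m → W) →ₗ[ℝ] (Bond d m → W)) ∘ₗ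
              ((((WL2.linearEquiv ℂ ℂ (fun _ : Bond d m => c₁) : BondL2K ℂ d m c₁ W ≃ₗ[ℂ] (Bond d m → W)).toLinearMap ∘ₗ
                  QkW L m n φ U hL αU hα1 hU1 hreg (c₀ := c₀) (c₁ := c₁) ∘ₗ
                  (WL2.linearEquiv ℂ ℂ (fun _ : Bond d (towerP L m (n + 1)) => c₀) :
                    BondL2K ℂ d (towerP L m (n + 1)) c₀ W ≃ₗ[ℂ] (Bond d (towerP L m (n + 1)) → W)).symm.toLinearMap).restrictScalars ℝ) ∘ₗ
                (G'.restrictScalars ℝ : (Bond d (towerP L m (n + 1)) → W) →ₗ[ℝ] (Bond d (towerP L m (n + 1)) → W)))) ∘ₗ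
            ((((WL2.linearEquiv ℂ ℂ (fun _ : Bond d (towerP L m (n + 1)) => c₀) :
                    BondL2K ℂ d (towerP L m (n + 1)) c₀ W ≃ₗ[ℂ] (Bond d (towerP L m (n + 1)) → W)).toLinearMap ∘ₗ D2 ∘ₗ
                (WL2.linearEquiv ℂ ℂ (fun _ : Bond d (towerP L m (n + 1)) => c₀) :
                  BondL2K ℂ d (towerP L m (n + 1)) c₀ W ≃ₗ[ℂ] (Bond d (towerP L m (n + 1)) → W)).symm.toLinearMap).restrictScalars ℝ) ∘ₗ
              (((WL2.linearEquiv ℂ ℂ (fun _ : Bond d (towerP L m (n + 1)) => c₀) :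
                    BondL2K ℂ d (towerP L m (n + 1)) c₀ W ≃ₗ[ℂ] (Bond d (towerP L m (n + 1)) → W)).toLinearMap ∘ₗ
                H1k L m n φ η U hL αU hα1 hU1 hreg τ (c₀ := c₀) (c₁ := c₁) hαL hpos ∘ₗ
                (WL2.linearEquiv ℂ ℂ (fun _ : Bond d m => c₁) : BondL2K ℂ d m c₁ W ≃ₗ[ℂ] (Bond d m → W)).symm.toLinearMap).restrictScalars ℝ)))
          (A₀ + BGt * θD * c) δ' := by
  obtain ⟨αs, B, δ, A', r₁, hαs, hB, hδ, hA', hr₁, HY⟩ := exists_ineq190_origin_tower_plaquette hd L hL hL3 φ hMφ hMφ' hφ hφ' ha ha' τ hτ hCτ hτm hMτ hρw hτ₁ hτ₂ hφτ AQ hAQ16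
  refine ⟨αs, B, δ, A', r₁, hαs, hB, hδ, hA', hr₁, ?_⟩
  intro n η hηL c₀ c₁ _ _ hw hρ m _ hm U hUu α hα hαle hUη hpl hUgrad αU hα1 hαL hU1 hreg hpos η₀ L₀ M₀ R H ρ σ c hσ hρ0 hρ₁ hρI hc_def D2 KD
    lam rD hlam hKD hDloc hDrow hDcol hD2 q BG' θP qI BI' A₀ θD BGt hq_def hq hBG' hθP hqI hqI1 hBI' hA₀ hθD hBGt
  obtain ⟨αU', hα1', hαL', hU1', hreg', hpos', h⟩ := HY n η hηL c₀ c₁ hw hρ m hm U hUu α hα hαle hUη hpl hUgrad η₀ L₀ M₀ R H ρ σ c hσ hρ0 hρ₁ hρI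
    hc_def D2 hlam hKD hDloc hDrow hDcol hD2 hq_def hq hBG' hθP hqI hqI1 hBI' hA₀ hθD hBGt
  rw [H1k_display_irrel L m n φ η U hL αU' αU hα1' hα1 hU1' hU1 hreg' hreg τ hαL' hαL hpos' hpos,
    laplaceAk_display_irrel L m n φ η U hL αU' αU hα1' hα1 hU1' hU1 hreg' hreg τ a,
    QkW_display_irrel L m n φ U hL αU' αU hα1' hα1 hU1' hU1 hreg' hreg (c₀ := c₀) (c₁ := c₁)] at h
  exact h

end Tower

end Literature.MathematicalPhysics.QuantumFieldTheory.Balaban1983to89.Beta.RemainderOriginTowerPlaquetteAnyDisplay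

end
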